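import Mathlib
import Summits.NavierStokesRegularity.NavierStokesRegularity.Theorems.EulerZoomLiouvillePowerGaugeEulerLiouvilleWeakConfinedVorticity
import Summits.NavierStokesRegularity.NavierStokesRegularity.Theorems.EulerZoomLiouvillePowerGaugeEulerLiouvilleIrrotationalTools
import Literature.Analysis.FluidPDE.WeakGradientIBP
import HarnessLib

/-!
# Crux `EulerZoomLiouville.PowerGaugeEulerLiouville` (stmt-NavierStokesRegularity-19832), weak stratum `stub_selfSimilarWeakRest`:
# the weak confined-vorticity member with an INTRINSIC hypothesis — `V` weakly irrotational outside a ball (curl-pair form, no `∃ G`)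

Route №10 `EulerZoomLiouville` (NavierStokesRegularity), crux E = stmt-NavierStokesRegularity-19832; width seat ns-ezl-w1 g8 under the LEAD
ns-typeII-p2 g14; sequel (3/3) of `…WeakConfinedVorticityTools` (p690361) and `…WeakConfinedVorticity` (p690763).  The member theorem there takes
a weak gradient `G` of the profile with `G` a.e. SYMMETRIC on `{‖y‖ > R₀}`.  Here the hypothesis is put on `V` ALONE, in the tree's curl-pair
vocabulary (`IrrotationalTools.integral_inner_curlPair_eq_zero_of_symm` is the converse direction): `V` is WEAKLY IRROTATIONAL OUTSIDE THE BALL,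

  `∀ g ∈ C_c^∞`, `tsupport g ⊆ {‖y‖ > R₀}`, `∀ a c`: `∫ ⟪V, (∂ₐ g) c − (∂_c g) a⟫ = 0`,

and the class's own profile gradient (`Past.profileData_of_past`) is shown to be a.e. symmetric there:

* `inner_clm_eq_sum`, `symm_of_symm_basis` — a linear map on `ℝ³` symmetric on the standard basis pairs is symmetric;
* `ae_symm_of_curlPair_eq_zero` — `HasWeakFDerivOn ⊤ volume V G` + curl-pair annihilation on the open exterior ⇒ `G` a.e. symmetric there (the
  vector weak-gradient identity `∫⟪V, ∂ₐW⟫ = −∫⟪G a, W⟫`, tree `HasWeakGradient.integral_inner_fderiv_apply_test`, and the fundamental lemma of the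
  calculus of variations on an open set, Mathlib `IsOpen.ae_eq_zero_of_integral_contDiff_smul_eq_zero`, over the nine basis pairs);
* `selfSimilar_ae_eq_zero_of_weaklyIrrotationalFar_profile` (+ `_past`) — MEMBER: `0 < ρ < ½`, crux hypotheses verbatim, exact self-similarity (origin /
  `(T,x₀)` on a past sub-slab), `V` weakly irrotational outside a ball ⇒ `u = 0` a.e.

Binder (over `V` only) proposed to the LEAD: `∃ R₀ : ℝ, ∀ g : E3 → ℝ, Literature.Analysis.FunctionSpaces.IsTestFunctionOn ⊤ g → tsupport g ⊆ {y | R₀ < ‖y‖} →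
∀ a c : E3, ∫ x, inner ℝ (V x) (fderiv ℝ g x a • c - fderiv ℝ g x c • a) = 0`.
WHAT THIS IS NOT: not NS, not E, not the weak stub — the intrinsic restatement of one weak sub-stratum member `--supports` stmt-19832; 19832 is OPEN.
[folklore; Evans2010 §5.2.1; ChaeShvydkoy2013 §4 Thm 4.1 (endgame)]
-/

noncomputable section

-- flat `Theorems/<Route><Decl>…` files of one crux share the namespace of the crux (tree convention)
set_option linter.dupNamespace false

open MeasureTheory Set Filter Topology Metric Function TopologicalSpace ContinuousLinearMap
open scoped ENNReal NNReal Convolution InnerProductSpace RealInnerProductSpace ContDiff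

namespace Summit.NavierStokesRegularity.NavierStokesRegularity.Theorems.PowerGaugeEulerLiouville.WeakConfinedVorticity

open Literature.Analysis Literature.Analysis.FunctionSpaces Literature.Analysis.FluidPDE
open Summit.NavierStokesRegularity.NavierStokesRegularity.Theorems.PowerGaugeEulerLiouville

/-! ### Linear algebra: symmetry on basis pairs suffices -/

/-- Coordinates of the bilinear form of a linear map on `ℝ³`: `⟪L v, w⟫ = Σᵢⱼ vᵢ wⱼ ⟪L eᵢ, eⱼ⟫` (`eᵢ = EuclideanSpace.single i 1`). [folklore] -/
theorem inner_clm_eq_sum (L : EuclideanSpace ℝ (Fin 3) →L[ℝ] EuclideanSpace ℝ (Fin 3)) (v w : EuclideanSpace ℝ (Fin 3)) :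
    ⟪L v, w⟫ = ∑ i, ∑ j, v i * w j * ⟪L (EuclideanSpace.single i (1 : ℝ)), EuclideanSpace.single j (1 : ℝ)⟫ := by
  have hv : v = ∑ i, v i • EuclideanSpace.single i (1 : ℝ) := by
    conv_lhs => rw [← (EuclideanSpace.basisFun (Fin 3) ℝ).sum_repr v]
    simp [EuclideanSpace.basisFun_apply]
  have hw : w = ∑ j, w j • EuclideanSpace.single j (1 : ℝ) := by
    conv_lhs => rw [← (EuclideanSpace.basisFun (Fin 3) ℝ).sum_repr w]
    simp [EuclideanSpace.basisFun_apply]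
  conv_lhs => rw [hv, hw]
  simp only [map_sum, map_smul, sum_inner, inner_sum, real_inner_smul_left, real_inner_smul_right]
  rw [Finset.sum_comm]
  refine Finset.sum_congr rfl fun i _ => Finset.sum_congr rfl fun j _ => ?_
  ring

/-- **A linear map on `ℝ³` symmetric on the standard basis pairs is symmetric.** [folklore] -/
theorem symm_of_symm_basis {L : EuclideanSpace ℝ (Fin 3) →L[ℝ] EuclideanSpace ℝ (Fin 3)}
    (h : ∀ i j : Fin 3, ⟪L (EuclideanSpace.single i (1 : ℝ)), EuclideanSpace.single j (1 : ℝ)⟫ =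
      ⟪L (EuclideanSpace.single j (1 : ℝ)), EuclideanSpace.single i (1 : ℝ)⟫)
    (v w : EuclideanSpace ℝ (Fin 3)) : ⟪L v, w⟫ = ⟪L w, v⟫ := by
  rw [inner_clm_eq_sum, inner_clm_eq_sum, Finset.sum_comm]
  refine Finset.sum_congr rfl fun j _ => Finset.sum_congr rfl fun i _ => ?_
  rw [h i j]
  ring

/-! ### Curl-pair annihilation on the exterior ⇒ the weak gradient is a.e. symmetric there -/

section Symm

variable {V : EuclideanSpace ℝ (Fin 3) → EuclideanSpace ℝ (Fin 3)}
  {G : EuclideanSpace ℝ (Fin 3) → EuclideanSpace ℝ (Fin 3) →L[ℝ] EuclideanSpace ℝ (Fin 3)}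

/-- The two pairings of the curl-pair test field against a field with a whole-space weak gradient:
`∫ ⟪V, (∂ₐ g) c⟫ = −∫ g ⟪G a, c⟫`. [folklore; Evans2010 §5.2.1] -/
theorem integral_inner_fderiv_smul_eq (hVG : HasWeakFDerivOn (⊤ : Opens (EuclideanSpace ℝ (Fin 3))) volume V G)
    {g : EuclideanSpace ℝ (Fin 3) → ℝ} (hg : IsTestFunctionOn (⊤ : Opens (EuclideanSpace ℝ (Fin 3))) g)
    (a c : EuclideanSpace ℝ (Fin 3)) :
    ∫ x, ⟪V x, fderiv ℝ g x a • c⟫ = -∫ x, g x * ⟪G x a, c⟫ := by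
  have hWc := isTestFunctionOn_smul_const hg c
  have h1 := HasWeakGradient.integral_inner_fderiv_apply_test (u := V) (G := G) hVG hWc a
  simp_rw [fderiv_smul_const_apply' hg] at h1
  rw [h1]
  congr 1
  refine integral_congr_ae (Eventually.of_forall fun x => ?_)
  simp only [real_inner_smul_right]

/-- Integrability of the pairing `x ↦ ⟪V x, (∂ₐ g)(x) c⟫`. [folklore] -/
theorem integrable_inner_fderiv_smul (hVG : HasWeakFDerivOn (⊤ : Opens (EuclideanSpace ℝ (Fin 3))) volume V G)
    {g : EuclideanSpace ℝ (Fin 3) → ℝ} (hg : IsTestFunctionOn (⊤ : Opens (EuclideanSpace ℝ (Fin 3))) g)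
    (a c : EuclideanSpace ℝ (Fin 3)) :
    Integrable (fun x => ⟪V x, fderiv ℝ g x a • c⟫) volume := by
  have hVl : LocallyIntegrable V volume := locallyIntegrableOn_univ.1 (by
    simpa only [Opens.coe_top] using hVG.locallyIntegrableOn)
  have hWc := isTestFunctionOn_smul_const hg c
  have := integrable_inner_of_locallyIntegrable_of_hasCompactSupport hVl
    ((hWc.contDiff.continuous_fderiv (by simp)).clm_apply continuous_const)
    (hWc.hasCompactSupport.fderiv_apply (𝕜 := ℝ) a)
  refine this.congr (Eventually.of_forall fun x => ?_)
  simp only [fderiv_smul_const_apply' hg]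

/-- Integrability of `x ↦ g x · ⟪G x a, c⟫` for a test function `g`. [folklore] -/
theorem integrable_mul_inner_apply (hVG : HasWeakFDerivOn (⊤ : Opens (EuclideanSpace ℝ (Fin 3))) volume V G)
    {g : EuclideanSpace ℝ (Fin 3) → ℝ} (hg : IsTestFunctionOn (⊤ : Opens (EuclideanSpace ℝ (Fin 3))) g)
    (a c : EuclideanSpace ℝ (Fin 3)) :
    Integrable (fun x => g x * ⟪G x a, c⟫) volume := by
  have hGl : LocallyIntegrable G volume := locallyIntegrableOn_univ.1 (by
    simpa only [Opens.coe_top] using hVG.locallyIntegrableOn_deriv)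
  have h1 : Integrable (fun x => g x • G x) volume :=
    hGl.integrable_smul_left_of_hasCompactSupport hg.contDiff.continuous hg.hasCompactSupport
  set T : (EuclideanSpace ℝ (Fin 3) →L[ℝ] EuclideanSpace ℝ (Fin 3)) →L[ℝ] ℝ :=
    (innerSL ℝ c).comp (ContinuousLinearMap.apply ℝ (EuclideanSpace ℝ (Fin 3)) a) with hT
  have h2 := T.integrable_comp h1
  refine h2.congr (Eventually.of_forall fun x => ?_)
  simp only [hT, map_smul, ContinuousLinearMap.comp_apply, ContinuousLinearMap.apply_apply,
    innerSL_apply_apply, smul_eq_mul, real_inner_comm]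

/-- **Curl-pair annihilation on `{‖y‖ > R₀}` makes the weak gradient a.e. symmetric there.**  `V` with whole-space weak gradient `G`;
if `∫ ⟪V, (∂ₐ g) c − (∂_c g) a⟫ = 0` for every test function `g` supported in the open exterior `{‖y‖ > R₀}` and all `a, c`, then for a.e.
`y` with `‖y‖ > R₀`, `G y` is a symmetric linear map. [folklore; Evans2010 §5.2.1] -/
theorem ae_symm_of_curlPair_eq_zero (hVG : HasWeakFDerivOn (⊤ : Opens (EuclideanSpace ℝ (Fin 3))) volume V G) {R₀ : ℝ}
    (hirr : ∀ g : EuclideanSpace ℝ (Fin 3) → ℝ, IsTestFunctionOn (⊤ : Opens (EuclideanSpace ℝ (Fin 3))) g →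
      tsupport g ⊆ {y : EuclideanSpace ℝ (Fin 3) | R₀ < ‖y‖} →
        ∀ a c : EuclideanSpace ℝ (Fin 3), ∫ x, ⟪V x, fderiv ℝ g x a • c - fderiv ℝ g x c • a⟫ = 0) :
    ∀ᵐ y ∂(volume : Measure (EuclideanSpace ℝ (Fin 3))), R₀ < ‖y‖ →
      ∀ v w : EuclideanSpace ℝ (Fin 3), ⟪G y v, w⟫ = ⟪G y w, v⟫ := by
  have hU : IsOpen {y : EuclideanSpace ℝ (Fin 3) | R₀ < ‖y‖} := isOpen_lt continuous_const continuous_norm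
  have hGl : LocallyIntegrable G volume := locallyIntegrableOn_univ.1 (by
    simpa only [Opens.coe_top] using hVG.locallyIntegrableOn_deriv)
  -- one pair `(a, c)` at a time
  have hpair : ∀ a c : EuclideanSpace ℝ (Fin 3), ∀ᵐ y ∂(volume : Measure (EuclideanSpace ℝ (Fin 3))),
      y ∈ {y : EuclideanSpace ℝ (Fin 3) | R₀ < ‖y‖} → ⟪G y a, c⟫ - ⟪G y c, a⟫ = 0 := by
    intro a c
    set Ta : (EuclideanSpace ℝ (Fin 3) →L[ℝ] EuclideanSpace ℝ (Fin 3)) →L[ℝ] ℝ :=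
      (innerSL ℝ c).comp (ContinuousLinearMap.apply ℝ (EuclideanSpace ℝ (Fin 3)) a) with hTa
    set Tc : (EuclideanSpace ℝ (Fin 3) →L[ℝ] EuclideanSpace ℝ (Fin 3)) →L[ℝ] ℝ :=
      (innerSL ℝ a).comp (ContinuousLinearMap.apply ℝ (EuclideanSpace ℝ (Fin 3)) c) with hTc
    have hli : LocallyIntegrable (fun y => ⟪G y a, c⟫ - ⟪G y c, a⟫) volume := by
      have h1 := locallyIntegrableOn_univ.1 ((Ta - Tc).locallyIntegrableOn_comp (locallyIntegrableOn_univ.2 hGl))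
      refine h1.congr (Eventually.of_forall fun y => ?_)
      simp only [hTa, hTc, Function.comp_apply, sub_apply, ContinuousLinearMap.comp_apply,
        ContinuousLinearMap.apply_apply, innerSL_apply_apply, real_inner_comm]
    refine hU.ae_eq_zero_of_integral_contDiff_smul_eq_zero (hli.locallyIntegrableOn _) fun g hg hgc hgU => ?_
    have hgt : IsTestFunctionOn (⊤ : Opens (EuclideanSpace ℝ (Fin 3))) g := ⟨hg, hgc, by simp⟩
    have h0 := hirr g hgt hgU a c
    have i1 := integrable_inner_fderiv_smul hVG hgt a c
    have i2 := integrable_inner_fderiv_smul hVG hgt c a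
    have i3 := integrable_mul_inner_apply hVG hgt a c
    have i4 := integrable_mul_inner_apply hVG hgt c a
    simp_rw [inner_sub_right] at h0
    rw [integral_sub i1 i2, integral_inner_fderiv_smul_eq hVG hgt a c, integral_inner_fderiv_smul_eq hVG hgt c a] at h0
    have h5 : ∫ x, g x * (⟪G x a, c⟫ - ⟪G x c, a⟫) = 0 := by
      simp_rw [mul_sub]
      rw [integral_sub i3 i4]
      linarith
    simpa only [smul_eq_mul] using h5
  -- all basis pairs at once
  have hall : ∀ᵐ y ∂(volume : Measure (EuclideanSpace ℝ (Fin 3))), ∀ i j : Fin 3,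
      y ∈ {y : EuclideanSpace ℝ (Fin 3) | R₀ < ‖y‖} →
        ⟪G y (EuclideanSpace.single i (1 : ℝ)), EuclideanSpace.single j (1 : ℝ)⟫ -
          ⟪G y (EuclideanSpace.single j (1 : ℝ)), EuclideanSpace.single i (1 : ℝ)⟫ = 0 :=
    ae_all_iff.2 fun i => ae_all_iff.2 fun j => hpair _ _
  filter_upwards [hall] with y hy hyU v w
  exact symm_of_symm_basis (fun i j => sub_eq_zero.1 (hy i j hyU)) v w

end Symm

/-! ### Member level, intrinsic hypothesis -/

section Member

/-- **WEAK CONFINED VORTICITY (INTRINSIC FORM), ORIGIN-CENTRED MEMBER** (`0 < ρ < ½`; crux hypotheses verbatim, binder shape of the skeleton's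
`IsExactlySelfSimilar`): if the velocity profile `V` of an exactly self-similar class member is WEAKLY IRROTATIONAL OUTSIDE A BALL —
`∫ ⟪V, (∂ₐ g) c − (∂_c g) a⟫ = 0` for all test `g` supported in `{‖y‖ > R₀}` and all `a, c` — then `u = 0` a.e.  (The class supplies the weak
gradient `G` via `Past.profileData_of_past`; `ae_symm_of_curlPair_eq_zero` makes it a.e. symmetric far out; then
`selfSimilar_ae_eq_zero_of_confinedCurl_profile`.) [folklore; ChaeShvydkoy2013 §4 Thm 4.1 (endgame) with §3.2 Thm 3.2] -/
theorem selfSimilar_ae_eq_zero_of_weaklyIrrotationalFar_profile {ρ : ℝ} (hρ : 0 < ρ) (hρ2 : ρ < 1 / 2)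
    {u : ℝ → EuclideanSpace ℝ (Fin 3) → EuclideanSpace ℝ (Fin 3)} {p : ℝ → EuclideanSpace ℝ (Fin 3) → ℝ}
    {H : ℝ → EuclideanSpace ℝ (Fin 3) → EuclideanSpace ℝ (Fin 3) →L[ℝ] EuclideanSpace ℝ (Fin 3)} {c : ℝ≥0}
    (hsw : IsSuitableWeakSolutionOn (slab (EuclideanSpace ℝ (Fin 3)) (Iio 0) isOpen_Iio) 0 0 u p)
    (hH : HasWeakSpatialGradientOn (slab (EuclideanSpace ℝ (Fin 3)) (Iio 0) isOpen_Iio) u H)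
    (hgauge : ∀ a : ℝ, 0 < a →
      ENNReal.ofReal (a ^ (2 * ρ)) * cknA a (0 : ℝ × EuclideanSpace ℝ (Fin 3)) u +
          ENNReal.ofReal (a ^ ρ) * cknE a (0 : ℝ × EuclideanSpace ℝ (Fin 3)) H +
        ENNReal.ofReal (a ^ (2 * ρ)) * cknD a (0 : ℝ × EuclideanSpace ℝ (Fin 3)) p ≤ (c : ℝ≥0∞))
    {V : EuclideanSpace ℝ (Fin 3) → EuclideanSpace ℝ (Fin 3)} {P : EuclideanSpace ℝ (Fin 3) → ℝ}
    (hu : ∀ τ : ℝ, τ < 0 → u τ = selfSimilarCollapse (1 / (2 + ρ)) 0 V τ)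
    (hp : ∀ τ : ℝ, τ < 0 → p τ = selfSimilarCollapsePressure (1 / (2 + ρ)) 0 P τ)
    {R₀ : ℝ}
    (hirr : ∀ g : EuclideanSpace ℝ (Fin 3) → ℝ, IsTestFunctionOn (⊤ : Opens (EuclideanSpace ℝ (Fin 3))) g →
      tsupport g ⊆ {y : EuclideanSpace ℝ (Fin 3) | R₀ < ‖y‖} →
        ∀ a c : EuclideanSpace ℝ (Fin 3), ∫ x, ⟪V x, fderiv ℝ g x a • c - fderiv ℝ g x c • a⟫ = 0) :
    uncurry u =ᵐ[volume.restrict (Iio (0 : ℝ) ×ˢ (univ : Set (EuclideanSpace ℝ (Fin 3))))] 0 := by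
  have hA : ∀ a : ℝ, 0 < a → ENNReal.ofReal (a ^ (2 * ρ)) *
      cknA a (0 : ℝ × EuclideanSpace ℝ (Fin 3)) u ≤ (c : ℝ≥0∞) :=
    fun a ha => le_trans (le_trans le_self_add le_self_add) (hgauge a ha)
  have hE : ∀ a : ℝ, 0 < a → ENNReal.ofReal (a ^ ρ) *
      cknE a (0 : ℝ × EuclideanSpace ℝ (Fin 3)) H ≤ (c : ℝ≥0∞) :=
    fun a ha => le_trans (le_trans le_add_self le_self_add) (hgauge a ha)
  have hD : ∀ a : ℝ, 0 < a → ENNReal.ofReal (a ^ (2 * ρ)) *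
      cknD a (0 : ℝ × EuclideanSpace ℝ (Fin 3)) p ≤ (c : ℝ≥0∞) :=
    fun a ha => le_trans le_add_self (hgauge a ha)
  have hu' : ∀ τ : ℝ, τ < 0 → u τ = fun x => selfSimilarCollapse (1 / (2 + ρ)) 0 V τ (x - 0) :=
    fun τ hτ => by rw [hu τ hτ]; funext x; rw [sub_zero]
  have hp' : ∀ τ : ℝ, τ < 0 → p τ = fun x => selfSimilarCollapsePressure (1 / (2 + ρ)) 0 P τ (x - 0) :=
    fun τ hτ => by rw [hp τ hτ]; funext x; rw [sub_zero]
  obtain ⟨G, -, -, -, hVG, -⟩ :=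
    Past.profileData_of_past hρ hρ2.le le_rfl le_rfl 0 hsw.distributional hH hA hE hD hu' hp'
  exact selfSimilar_ae_eq_zero_of_confinedCurl_profile hρ hρ2 hsw hH hgauge hu hp hVG
    (ae_symm_of_curlPair_eq_zero hVG hirr)

/-- **WEAK CONFINED VORTICITY (INTRINSIC FORM), PAST/SHIFTED MEMBER** (`0 < ρ < ½`): exactly self-similar about `(T, x₀)` for `τ < T₁`
(`T₁ ≤ 0`, `T₁ ≤ T`), velocity profile weakly irrotational outside a ball ⇒ `u = 0` a.e. [folklore; ChaeShvydkoy2013 §4 Thm 4.1 (endgame)] -/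
theorem selfSimilar_ae_eq_zero_of_weaklyIrrotationalFar_profile_past {ρ : ℝ} (hρ : 0 < ρ) (hρ2 : ρ < 1 / 2)
    {T T₁ : ℝ} (hT₁ : T₁ ≤ 0) (hTT₁ : T₁ ≤ T) (x₀ : EuclideanSpace ℝ (Fin 3))
    {u : ℝ → EuclideanSpace ℝ (Fin 3) → EuclideanSpace ℝ (Fin 3)} {p : ℝ → EuclideanSpace ℝ (Fin 3) → ℝ}
    {H : ℝ → EuclideanSpace ℝ (Fin 3) → EuclideanSpace ℝ (Fin 3) →L[ℝ] EuclideanSpace ℝ (Fin 3)} {c : ℝ≥0}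
    (hsw : IsSuitableWeakSolutionOn (slab (EuclideanSpace ℝ (Fin 3)) (Iio 0) isOpen_Iio) 0 0 u p)
    (hH : HasWeakSpatialGradientOn (slab (EuclideanSpace ℝ (Fin 3)) (Iio 0) isOpen_Iio) u H)
    (hgauge : ∀ a : ℝ, 0 < a →
      ENNReal.ofReal (a ^ (2 * ρ)) * cknA a (0 : ℝ × EuclideanSpace ℝ (Fin 3)) u +
          ENNReal.ofReal (a ^ ρ) * cknE a (0 : ℝ × EuclideanSpace ℝ (Fin 3)) H +
        ENNReal.ofReal (a ^ (2 * ρ)) * cknD a (0 : ℝ × EuclideanSpace ℝ (Fin 3)) p ≤ (c : ℝ≥0∞))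
    {V : EuclideanSpace ℝ (Fin 3) → EuclideanSpace ℝ (Fin 3)} {P : EuclideanSpace ℝ (Fin 3) → ℝ}
    (hu : ∀ τ : ℝ, τ < T₁ → u τ = fun x => selfSimilarCollapse (1 / (2 + ρ)) T V τ (x - x₀))
    (hp : ∀ τ : ℝ, τ < T₁ → p τ = fun x => selfSimilarCollapsePressure (1 / (2 + ρ)) T P τ (x - x₀))
    {R₀ : ℝ}
    (hirr : ∀ g : EuclideanSpace ℝ (Fin 3) → ℝ, IsTestFunctionOn (⊤ : Opens (EuclideanSpace ℝ (Fin 3))) g →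
      tsupport g ⊆ {y : EuclideanSpace ℝ (Fin 3) | R₀ < ‖y‖} →
        ∀ a c : EuclideanSpace ℝ (Fin 3), ∫ x, ⟪V x, fderiv ℝ g x a • c - fderiv ℝ g x c • a⟫ = 0) :
    uncurry u =ᵐ[volume.restrict (Iio (0 : ℝ) ×ˢ (univ : Set (EuclideanSpace ℝ (Fin 3))))] 0 := by
  have hA : ∀ a : ℝ, 0 < a → ENNReal.ofReal (a ^ (2 * ρ)) *
      cknA a (0 : ℝ × EuclideanSpace ℝ (Fin 3)) u ≤ (c : ℝ≥0∞) :=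
    fun a ha => le_trans (le_trans le_self_add le_self_add) (hgauge a ha)
  have hE : ∀ a : ℝ, 0 < a → ENNReal.ofReal (a ^ ρ) *
      cknE a (0 : ℝ × EuclideanSpace ℝ (Fin 3)) H ≤ (c : ℝ≥0∞) :=
    fun a ha => le_trans (le_trans le_add_self le_self_add) (hgauge a ha)
  have hD : ∀ a : ℝ, 0 < a → ENNReal.ofReal (a ^ (2 * ρ)) *
      cknD a (0 : ℝ × EuclideanSpace ℝ (Fin 3)) p ≤ (c : ℝ≥0∞) :=
    fun a ha => le_trans le_add_self (hgauge a ha)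
  obtain ⟨G, -, -, -, hVG, -⟩ :=
    Past.profileData_of_past hρ hρ2.le hT₁ hTT₁ x₀ hsw.distributional hH hA hE hD hu hp
  exact selfSimilar_ae_eq_zero_of_confinedCurl_profile_past hρ hρ2 hT₁ hTT₁ x₀ hsw hH hgauge hu hp hVG
    (ae_symm_of_curlPair_eq_zero hVG hirr)

end Member

end Summit.NavierStokesRegularity.NavierStokesRegularity.Theorems.PowerGaugeEulerLiouville.WeakConfinedVorticity

end
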